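import Summits.BirchSwinnertonDyer.BirchSwinnertonDyer.Theorems.AlignedTransportAtTwoMainConjectureTransportAlignedAtTwoSharedCubicTorsion
import Summits.BirchSwinnertonDyer.BirchSwinnertonDyer.Theorems.AlignedTransportAtTwoMainConjectureTransportAlignedAtTwoBuzzardGalois
import HarnessLib

/-!
# Crux C1 `MainConjectureTransportAlignedAtTwo` (stmt-BirchSwinnertonDyer-22296), line `birth`: the Galois-equivariant
# `W₁[2] ≃ W₂[2]` of an `S₃` pair is UNIQUE (width seat att-p4 g11; `--supports 22296`)

THEOREMS ONLY (no `def`, no named fact, no `sorry`). BSD is not proved by this; C1 is not closed by this.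

The lead's `…SharedCubicTorsion.exists_equivariant_addEquiv_of_sharedCubicField` (att-p1 g9) produces, from the crux's shared cubic
field, a `Γ_ℚ`-equivariant additive isomorphism `W₁[2] ≃+ W₂[2]`. This file proves that such an isomorphism is UNIQUE as soon as
`ρ̄_{W₂,2}` is onto `Aut(W₂[2]) ≅ GL₂(𝔽₂)` — i.e. (Dokchitser–Dokchitser (1), tree theorem `hasSurjectiveModNGaloisRep_two_iff`) as soon as
`W₂` has no rational `2`-torsion abscissa and `Δ(W₂) ∉ ℚ²`, the crux's binder: the centraliser of `GL₂(𝔽₂) ≅ S₃` in `Aut((ℤ/2)²)` is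
trivial (Schur for the absolutely irreducible `ρ̄`).

* §1 `addEquiv_eq_refl_of_forall_smul_comm` — an additive automorphism of `W[2]` commuting with `Γ_ℚ` is the identity (`W` an `S₃`-curve):
  transported to the frame `W[2] ≃+ (ℤ/2)²` it commutes with the coordinate swap and with the shear `(a,b) ↦ (a, a+b)` (both are some
  `ρ̄(σ)` by surjectivity), which pins it to the identity by a four-element computation.
* §2 `equivariant_addEquiv_unique` — two `Γ_ℚ`-equivariant `W₁[2] ≃+ W₂[2]` coincide (hypotheses on `W₂` only: no rational `2`-torsion
  abscissa, `¬ IsSquare W₂.Δ`); `existsUnique_equivariant_addEquiv_of_sharedCubicField` — with the lead's existence, `∃!`.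

USE (residual of the line, `Δ > 0`): any identification of `W₁[2]` with `W₂[2]` that is compatible with `Γ_ℚ` — for instance one factoring
through a multiplicity-one Hecke module `J₀(N′)[𝔪]` — IS the cubic-field matching `T_{j₁(σ)} ↦ T_{j₂(σ)}`; so «alignment at `∞`» constrains
every such identification, not only the field-theoretic one. (For `Δ < 0` the lead's Buzzard road does not need this.)

References: Silverman AEC III.§7 [SilvermanAEC2009]; Dokchitser–Dokchitser, Math. Z. 272 (2012) Thm (1) [DokchitserDokchitserMathZ2012];
Darmon–Diamond–Taylor Prop. 2.11 [DarmonDiamondTaylor1995].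
-/

noncomputable section

-- justification: the `Summit.BirchSwinnertonDyer.BirchSwinnertonDyer.…` path repeats a component (route-file convention)
set_option linter.dupNamespace false
set_option autoImplicit false

open scoped Classical
open Polynomial WeierstrassCurve Module
open Literature.NumberTheory.EllipticCurves Literature.NumberTheory.EllipticCurves.Greenberg1999
open Literature.NumberTheory.EllipticCurves.DokchitserDokchitser2012
open Summit.BirchSwinnertonDyer.Rank1Residual.F1Sign2
open Summit.BirchSwinnertonDyer.BirchSwinnertonDyer.Theorems.AlignedTransportAtTwoBuzzardGalois
open Summit.BirchSwinnertonDyer.BirchSwinnertonDyer.Theorems.AlignedTransportAtTwoSharedCubicTorsion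

namespace Summit.BirchSwinnertonDyer.BirchSwinnertonDyer.Theorems.AlignedTransportAtTwoSharedCubicTorsionUnique

/-! ## §1 An automorphism of `W[2]` commuting with an onto `ρ̄` is the identity -/

section OneCurve

variable (W : WeierstrassCurve ℚ) [W.IsElliptic]

/-- **An additive automorphism of `(ℤ/2)²` commuting with the coordinate swap and with the shear `(a, b) ↦ (a, a + b)` is the identity**
(the centraliser of `GL₂(𝔽₂) = ⟨swap, shear⟩` in `Aut((ℤ/2)²)` is trivial). Four-element computation. [folklore] -/
theorem addEquiv_prod_eq_refl_of_comm (f : ZMod 2 × ZMod 2 ≃+ ZMod 2 × ZMod 2)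
    (hswap : ∀ v, f (AddEquiv.prodComm v) = AddEquiv.prodComm (f v))
    (hshear : ∀ v, f (shear v) = shear (f v)) : f = AddEquiv.refl _ := by
  -- `f (0,1) = swap (f (1,0))` and `f (0,1)` is fixed by the shear
  set a := f (1, 0) with ha
  have h01 : f (0, 1) = (a.2, a.1) := by
    have h := hswap (1, 0)
    exact h
  have hfix : shear (f (0, 1)) = f (0, 1) := by
    have h := hshear (0, 1)
    rw [← h]
    rfl
  have hq : a.2 = 0 := by
    rw [h01] at hfix
    have h3 : a.2 + a.1 = a.1 := (Prod.ext_iff.mp hfix).2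
    simpa using h3
  have ha0 : a ≠ 0 := fun h ↦ by
    have : ((1, 0) : ZMod 2 × ZMod 2) = 0 := f.injective (by rw [← ha, h, map_zero])
    exact absurd (Prod.ext_iff.mp this).1 (by decide)
  have hp : a.1 = 1 := by
    rcases (by decide : ∀ x : ZMod 2, x = 0 ∨ x = 1) a.1 with h | h
    · exact absurd (Prod.ext h hq) ha0
    · exact h
  have ha1 : f (1, 0) = (1, 0) := by rw [← ha]; exact Prod.ext hp hq
  have hb1 : f (0, 1) = (0, 1) := by rw [h01, hq, hp]
  have h11 : f (1, 1) = (1, 1) := by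
    rw [show ((1, 1) : ZMod 2 × ZMod 2) = (1, 0) + (0, 1) by rfl, map_add, ha1, hb1]
  refine AddEquiv.ext fun v ↦ ?_
  rw [AddEquiv.refl_apply]
  obtain ⟨x, y⟩ := v
  fin_cases x <;> fin_cases y
  · exact map_zero f
  · exact hb1
  · exact ha1
  · exact h11

/-- **An additive automorphism of `W[2]` commuting with `Γ_ℚ` is the identity** when `ρ̄_{W,2}` is onto (`W/ℚ` elliptic without rational
`2`-torsion abscissa and with `Δ ∉ ℚ²` — Dokchitser–Dokchitser (1)): in the frame `W[2] ≃+ (ℤ/2)²` it commutes with the swap and the shear,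
each of which is `ρ̄(σ)` for some `σ`. (Schur: `End_{Γ}(ρ̄) = 𝔽₂` for the absolutely irreducible `ρ̄`.) [cite: DokchitserDokchitserMathZ2012, Theorem (1)]
[cite: SilvermanAEC2009, III.§7] -/
theorem addEquiv_eq_refl_of_forall_smul_comm (ht : ∀ x : ℚ, ¬ HasRationalTwoTorsionX W x) (hΔ : ¬ IsSquare W.Δ)
    (φ : geomTorsion W (2 : ℤ) ≃+ geomTorsion W (2 : ℤ))
    (hφ : ∀ (σ : Field.absoluteGaloisGroup ℚ) (P : geomTorsion W (2 : ℤ)), φ (σ • P) = σ • φ P) :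
    φ = AddEquiv.refl _ := by
  have hsurj : W.HasSurjectiveModNGaloisRep 2 :=
    (hasSurjectiveModNGaloisRep_two_iff W).mpr ⟨forall_two_nsmul_eq_zero_of_forall_not_hasRationalTwoTorsionX W ht, hΔ⟩
  -- every additive automorphism `ψ` of `W[2]` is some `ρ̄(σ)`, hence commutes with `φ`
  have hcomm : ∀ (ψ : geomTorsion W (2 : ℤ) ≃+ geomTorsion W (2 : ℤ)) (P : geomTorsion W (2 : ℤ)), φ (ψ P) = ψ (φ P) := by
    intro ψ P
    obtain ⟨σ, hσ⟩ := hsurj (Multiplicative.ofAdd ψ)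
    have hσP : ∀ Q : geomTorsion W (2 : ℤ), σ • Q = ψ Q := fun Q ↦ by
      rw [← galoisRepTorsion_apply W 2 σ Q, hσ]; rfl
    rw [← hσP, ← hσP, hφ]
  have h2 : (2 : ℚ) ≠ 0 := two_ne_zero
  set e := frame W h2 with he
  -- transport `φ` to the frame
  set f : ZMod 2 × ZMod 2 ≃+ ZMod 2 × ZMod 2 := e.symm.trans (φ.trans e) with hf
  have hfv : ∀ v, f v = e (φ (e.symm v)) := fun v ↦ rfl
  have hf1 : f = AddEquiv.refl _ := by
    refine addEquiv_prod_eq_refl_of_comm f (fun v ↦ ?_) (fun v ↦ ?_)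
    · -- the swap is `swapAut = e ∘ prodComm ∘ e⁻¹`-transported
      have h := hcomm (swapAut W h2) (e.symm v)
      rw [hfv, hfv]
      change e (φ (e.symm (AddEquiv.prodComm v))) = AddEquiv.prodComm (e (φ (e.symm v)))
      have hs : ∀ Q : geomTorsion W (2 : ℤ), swapAut W h2 Q = e.symm (AddEquiv.prodComm (e Q)) := fun Q ↦ rfl
      rw [hs, hs, AddEquiv.apply_symm_apply] at h
      rw [h, AddEquiv.apply_symm_apply]
    · have h := hcomm (shearAut W h2) (e.symm v)
      rw [hfv, hfv]
      have hs : ∀ Q : geomTorsion W (2 : ℤ), shearAut W h2 Q = e.symm (shear (e Q)) := fun Q ↦ rfl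
      rw [hs, hs, AddEquiv.apply_symm_apply] at h
      rw [h, AddEquiv.apply_symm_apply]
  refine AddEquiv.ext fun P ↦ ?_
  have h := congrArg (fun g : ZMod 2 × ZMod 2 ≃+ ZMod 2 × ZMod 2 ↦ e.symm (g (e P))) hf1
  simp only [hfv, AddEquiv.symm_apply_apply, AddEquiv.refl_apply] at h
  rw [AddEquiv.refl_apply]
  exact h

end OneCurve

/-! ## §2 Uniqueness of the equivariant `W₁[2] ≃+ W₂[2]` -/

section TwoCurves

variable (W₁ W₂ : WeierstrassCurve ℚ) [W₂.IsElliptic]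

/-- **Two `Γ_ℚ`-equivariant additive isomorphisms `W₁[2] ≃+ W₂[2]` coincide** when `W₂` has no rational `2`-torsion abscissa and
`Δ(W₂) ∉ ℚ²` (the crux's binder): `e⁻¹ ∘ e'` is a `Γ_ℚ`-automorphism of `W₂[2]`, hence the identity (§1). So the cubic-field matching
of `…SharedCubicTorsion.exists_equivariant_addEquiv_of_sharedCubicField` is THE Galois identification of the two `2`-torsions.
[cite: DokchitserDokchitserMathZ2012, Theorem (1)] [cite: SilvermanAEC2009, III.§7] -/
theorem equivariant_addEquiv_unique (ht₂ : ∀ x : ℚ, ¬ HasRationalTwoTorsionX W₂ x) (hΔ₂ : ¬ IsSquare W₂.Δ)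
    (e e' : geomTorsion W₁ (2 : ℤ) ≃+ geomTorsion W₂ (2 : ℤ))
    (he : ∀ (σ : Field.absoluteGaloisGroup ℚ) (P : geomTorsion W₁ (2 : ℤ)), e (σ • P) = σ • e P)
    (he' : ∀ (σ : Field.absoluteGaloisGroup ℚ) (P : geomTorsion W₁ (2 : ℤ)), e' (σ • P) = σ • e' P) :
    e = e' := by
  set φ : geomTorsion W₂ (2 : ℤ) ≃+ geomTorsion W₂ (2 : ℤ) := e.symm.trans e' with hφ
  have hφσ : ∀ (σ : Field.absoluteGaloisGroup ℚ) (Q : geomTorsion W₂ (2 : ℤ)), φ (σ • Q) = σ • φ Q := by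
    intro σ Q
    change e' (e.symm (σ • Q)) = σ • e' (e.symm Q)
    have h1 : e.symm (σ • Q) = σ • e.symm Q := by
      apply e.injective
      rw [AddEquiv.apply_symm_apply, he, AddEquiv.apply_symm_apply]
    rw [h1, he']
  have hid := addEquiv_eq_refl_of_forall_smul_comm W₂ ht₂ hΔ₂ φ hφσ
  refine AddEquiv.ext fun P ↦ ?_
  have h := congrArg (fun g : geomTorsion W₂ (2 : ℤ) ≃+ geomTorsion W₂ (2 : ℤ) ↦ g (e P)) hid
  simp only [hφ, AddEquiv.trans_apply, AddEquiv.symm_apply_apply, AddEquiv.refl_apply] at h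
  exact h.symm

variable [W₁.IsElliptic] {F : Type*} [Field F] [Algebra ℚ F] [FiniteDimensional ℚ F]

/-- **`∃!`: on the crux's shared cubic field there is EXACTLY ONE `Γ_ℚ`-equivariant additive isomorphism `W₁[2] ≃+ W₂[2]`** (existence:
the lead's `exists_equivariant_addEquiv_of_sharedCubicField`; uniqueness: §2, using `¬ IsSquare W₂.Δ`). [cite: DokchitserDokchitserMathZ2012, Theorem (1)]
[cite: DarmonDiamondTaylor1995, Prop. 2.11 (a)] -/
theorem existsUnique_equivariant_addEquiv_of_sharedCubicField (hF : finrank ℚ F = 3)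
    (ht₁ : ∀ x : ℚ, ¬ HasRationalTwoTorsionX W₁ x) (ht₂ : ∀ x : ℚ, ¬ HasRationalTwoTorsionX W₂ x) (hΔ₂ : ¬ IsSquare W₂.Δ)
    {e₁ e₂ : F} (he₁ : aeval e₁ (twoDivisionUCubic W₁) = 0) (he₂ : aeval e₂ (twoDivisionUCubic W₂) = 0) :
    ∃! e : geomTorsion W₁ (2 : ℤ) ≃+ geomTorsion W₂ (2 : ℤ),
      ∀ (σ : Field.absoluteGaloisGroup ℚ) (P : geomTorsion W₁ (2 : ℤ)), e (σ • P) = σ • e P := by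
  obtain ⟨e, he⟩ := exists_equivariant_addEquiv_of_sharedCubicField W₁ W₂ hF ht₁ ht₂ he₁ he₂
  exact ⟨e, he, fun e' he' ↦ equivariant_addEquiv_unique W₁ W₂ ht₂ hΔ₂ e' e he' he⟩

end TwoCurves

end Summit.BirchSwinnertonDyer.BirchSwinnertonDyer.Theorems.AlignedTransportAtTwoSharedCubicTorsionUnique

end
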